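import Mathlib.CategoryTheory.Galois.Full
import Literature.AnabelianGeometry.Anabelioids.Basic
import Literature.AnabelianGeometry.Anabelioids.ObjectsFromActions

/-!
# Objects with free fibres ("trivialising coverings") in a connected anabelioid

[SGA1, Exp. V §5] / Mochizuki, *The geometry of anabelioids*, §1.1 p. 10 [cite: MochizukiGeoAn2004,
§1.1 p.10]: in a connected anabelioid `C` with basepoint `F` and FINITE `π₁ = Aut F` the "universal
covering" exists as an object — more generally, for every `k ≥ 1` there is an object whose fibre is a
FREE `Aut F`-set with `k · |Aut F|` points (`exists_obj_free_fiber`).  Freeness of the fibre does not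
depend on the basepoint (`free_fiber_of_iso`), is detected through an exact functor by the induced map
on fundamental groups (`pi1Map_eq_one_of_free`), and objects with free fibres of the same size are
isomorphic (`nonempty_iso_of_equivariant_equiv` + `FreeFiniteActions`).  Bricks for the "free" finite
étale coverings in [IUTchI] Rmk. 2.5.3 (i) (T4).  Proof-only (no definitions).
-/

namespace Literature.AnabelianGeometry.Anabelioids

open CategoryTheory CategoryTheory.PreGaloisCategory

universe w v₂ u₂' u₂ u₁

variable {C : Type u₁} [Category.{u₂} C]

/-- An `Aut F`-equivariant bijection between fibres comes from an isomorphism of `C` (fullness of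
`C ⥤ Aut F-FinSets`). [cite: MochizukiGeoAn2004, §1.1 p.10] -/
theorem nonempty_iso_of_equivariant_equiv [GaloisCategory C] (F : C ⥤ FintypeCat.{w}) [FiberFunctor F]
    {X₁ X₂ : C}
    (e : F.obj X₁ ≃ F.obj X₂) (he : ∀ (σ : Aut F) (x : F.obj X₁), e (σ • x) = σ • e x) :
    Nonempty (X₁ ≅ X₂) := by
  let i : (functorToAction F).obj X₁ ≅ (functorToAction F).obj X₂ :=
    Action.mkIso (FintypeCat.equivEquivIso e) fun σ => by
      ext x
      exact he σ x
  exact ⟨(functorToAction F).preimageIso i⟩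

/-- Freeness of the `π₁`-action on a fibre is independent of the basepoint: transport along an
isomorphism of fibre functors. [cite: MochizukiGeoAn2004, §1.1 p.10] -/
theorem free_fiber_of_iso {F F' : C ⥤ FintypeCat.{w}} (α : F ≅ F') (S : C)
    (h : ∀ (σ : Aut F) (x : F.obj S), σ • x = x → σ = 1) :
    ∀ (σ' : Aut F') (x' : F'.obj S), σ' • x' = x' → σ' = 1 := by
  intro σ' x' hx
  let σ : Aut F := α ≪≫ σ' ≪≫ α.symm
  have hσ : σ • α.inv.app S x' = α.inv.app S x' := by
    rw [mulAction_def]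
    change (α.hom ≫ σ'.hom ≫ α.inv).app S (α.inv.app S x') = _
    simp only [NatTrans.comp_app, FintypeCat.comp_apply]
    rw [← FintypeCat.comp_apply (α.inv.app S) (α.hom.app S), ← NatTrans.comp_app, α.inv_hom_id,
      NatTrans.id_app, FintypeCat.id_apply]
    change α.inv.app S (σ' • x') = _
    rw [hx]
  have h1 : σ = 1 := h σ _ hσ
  have : σ' = α.symm ≪≫ σ ≪≫ α := by
    simp [σ]
  rw [this, h1]
  change α.symm ≪≫ Iso.refl F ≪≫ α = Iso.refl F'
  simp

variable {D : Type u₂'} [Category.{v₂} D]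

/-- Through an exact functor `P : D ⥤ C` (a morphism of connected anabelioids `C → D`), the action of
`σ ∈ Aut F` on the fibre `F(P S') = (P ⋙ F)(S')` is that of `π₁(P)(σ)`; so if `Aut (P ⋙ F)` acts
freely on that fibre, a `σ` fixing a point lies in the kernel of `π₁(P)`.
[cite: MochizukiGeoAn2004, Def. 1.1.2(ii) p.10] -/
theorem pi1Map_eq_one_of_free (P : D ⥤ C) (F : C ⥤ FintypeCat.{w}) (S' : D)
    (h : ∀ (τ : Aut (P ⋙ F)) (x : (P ⋙ F).obj S'), τ • x = x → τ = 1)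
    (σ : Aut F) (x : F.obj (P.obj S')) (hx : σ • x = x) : pi1Map P F σ = 1 :=
  h (pi1Map P F σ) x hx

/-- If moreover `π₁(P)` is injective (`P` is a `π₁`-monomorphism at `F`), `Aut F` itself acts freely on
`F(P S')`. [cite: MochizukiGeoAn2004, Def. 1.1.7(ii) p.14] -/
theorem free_fiber_of_pi1Map_injective (P : D ⥤ C) (F : C ⥤ FintypeCat.{w}) (S' : D)
    (hP : Function.Injective (pi1Map P F))
    (h : ∀ (τ : Aut (P ⋙ F)) (x : (P ⋙ F).obj S'), τ • x = x → τ = 1) :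
    ∀ (σ : Aut F) (x : F.obj (P.obj S')), σ • x = x → σ = 1 :=
  fun σ x hx => hP ((pi1Map_eq_one_of_free P F S' h σ x hx).trans (map_one _).symm)

/-- **Objects with free fibres**: if `π₁ = Aut F` is finite, then for every `k` there is an object `S`
of `C` on whose fibre `Aut F` acts freely with `k · |Aut F|` points (the disjoint union of `k` copies of
the universal covering). [cite: MochizukiGeoAn2004, §1.1 p.10] -/
theorem exists_obj_free_fiber [GaloisCategory C] (F : C ⥤ FintypeCat.{w}) [FiberFunctor F]
    [Finite (Aut F)] (k : ℕ) :
    ∃ S : C, (∀ (σ : Aut F) (x : F.obj S), σ • x = x → σ = 1) ∧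
      Nat.card (F.obj S) = k * Nat.card (Aut F) := by
  classical
  -- `Aut F` acting on `Fin k × Aut F` by left translation on the second factor, transported to a
  -- numbering `Aut F ≃ Fin m` so that the set lives in the universe of the fibres
  obtain ⟨m, ⟨ε⟩⟩ := Finite.exists_equiv_fin (Aut F)
  let Y : Type w := ULift.{w} (Fin k × Fin m)
  letI : MulAction (Aut F) Y :=
    { smul := fun σ p => ⟨(p.down.1, ε (σ * ε.symm p.down.2))⟩
      one_smul := fun p => by
        apply ULift.ext
        change (p.down.1, ε (1 * ε.symm p.down.2)) = p.down
        rw [one_mul, Equiv.apply_symm_apply]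
      mul_smul := fun σ τ p => by
        apply ULift.ext
        change (p.down.1, ε (σ * τ * ε.symm p.down.2)) = (p.down.1, ε (σ * ε.symm (ε (τ * ε.symm p.down.2))))
        rw [Equiv.symm_apply_apply, mul_assoc] }
  have hfree : ∀ (σ : Aut F) (y : Y), σ • y = y → σ = 1 := by
    intro σ y hy
    have h1 := congrArg (fun q : Y => ε.symm q.down.2) hy
    change ε.symm (ε (σ * ε.symm y.down.2)) = ε.symm y.down.2 at h1
    rw [Equiv.symm_apply_apply] at h1
    exact mul_eq_right.mp h1
  have hopen : ∀ y : Y, IsOpen (MulAction.stabilizer (Aut F) y : Set (Aut F)) :=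
    fun y => isOpen_discrete _
  obtain ⟨S, e, he⟩ := exists_obj_of_aut_action F Y hopen
  refine ⟨S, fun σ x hx => hfree σ (e x) (by rw [← he, hx]), ?_⟩
  rw [Nat.card_congr e, Nat.card_ulift, Nat.card_prod, Nat.card_eq_fintype_card (α := Fin k),
    Fintype.card_fin, ← Nat.card_congr ε]

end Literature.AnabelianGeometry.Anabelioids
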